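import Summits.QuantumFields.QCD.Theses.GaussianLinkFrames
import Literature.MathematicalPhysics.QuantumFieldTheory.Balaban1983to89.HaarSmallBallClosedSubgroup
import Literature.Barriers.QuantumFields.UnitaryHaarSmallBall
import HarnessLib

/-!
# Route `GaussianLinkFrames` (QCD sub-problem) — the support `TiltedHaarFlatness` (stmt-QuantumFields-17377), PROVED

Single-link flatness of the tilted Haar (matrix von Mises–Fisher) law on `SU(3)`:
`e^{Re tr(U₀Jᴴ)} ≤ C·(1+B)^8 · ∫ e^{Re tr(UJᴴ)} dHaar(U)` for every `J` with entries `≤ B` and every `U₀ ∈ SU(3)`.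

Proof (Laplace lower bound): by left invariance `∫ e^{Re tr(UJᴴ)} dU = ∫ e^{Re tr(U₀VJᴴ)} dV`; on the operator-norm ball `‖V − 1‖ ≤ r`,
`r = (1 + 27B)⁻¹`, the entrywise bound `|tr(U₀(V−1)Jᴴ)| ≤ 27·1·r·B ≤ 1` (unitary entries `≤ 1`, entries `≤` operator norm, `|J_{ik}| ≤ B`)
gives `e^{Re tr(U₀VJᴴ)} ≥ e^{Re tr(U₀Jᴴ) − 1}`, and the tree's Haar small-ball bound on `SU(N)`
(`HaarSmallBallClosedSubgroup.haar_ball_ge_specialUnitaryGroup`: `Haar{‖V−1‖ ≤ r} ≥ c·r^{N²−1}`, here `r⁸`) yields the claim with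
`C = e·27⁸/c`, `p = 8`.

Only this support item is proved; no QCD / Yang–Mills summit statement.  Cell `ym-idea-1`, LEAD seat `ym-line-sfw-p2` g71 (free hands),
`--workitem stmt-QuantumFields-17377`.
References: H. Vairinhos, P. de Forcrand, JHEP 12 (2014) 038 [VairinhosDeforcrand2014]; T. Bröcker, T. tom Dieck (1985) I (2.18) (Haar small balls).
-/

set_option autoImplicit false

noncomputable section

open MeasureTheory Complex
open scoped ComplexConjugate Matrix Matrix.Norms.L2Operator ENNReal
open Literature.MathematicalPhysics.QuantumFieldTheory (haarProbability)
open Literature.MathematicalPhysics.QuantumFieldTheory.Balaban1983to89.HaarSmallBallClosedSubgroup (haar_ball_ge_specialUnitaryGroup)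
open Literature.Barriers.QuantumFields (norm_entry_le_l2_opNorm)

namespace Summit.QuantumFields.QCD.Theorems.GaussianLinkFramesTiltedHaarFlatness

/-! ## §1 The entrywise trace bound -/

/-- `|Re tr(U₀ X Jᴴ)| ≤ 27·r·B` on `M₃(ℂ)` when `U₀` has entries of norm `≤ 1`, `X` has entries of norm `≤ r` and `J` has entries of norm
`≤ B`. [folklore] -/
theorem abs_re_trace_mul_mul_le {U₀ X J : Matrix (Fin 3) (Fin 3) ℂ} {r B : ℝ}
    (hU : ∀ i j, ‖U₀ i j‖ ≤ 1) (hX : ∀ i j, ‖X i j‖ ≤ r) (hJ : ∀ i j, ‖J i j‖ ≤ B) :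
    |((U₀ * X * Jᴴ).trace).re| ≤ 27 * r * B := by
  have hr : 0 ≤ r := (norm_nonneg _).trans (hX 0 0)
  have hB : 0 ≤ B := (norm_nonneg _).trans (hJ 0 0)
  calc |((U₀ * X * Jᴴ).trace).re| ≤ ‖(U₀ * X * Jᴴ).trace‖ := Complex.abs_re_le_norm _
    _ = ‖∑ i, ∑ k, (∑ j, U₀ i j * X j k) * (starRingEnd ℂ) (J i k)‖ := by
        simp only [Matrix.trace, Matrix.diag, Matrix.mul_apply, Matrix.conjTranspose_apply, Complex.star_def]
    _ ≤ ∑ i, ∑ k, ∑ j, 1 * r * B := by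
        refine (norm_sum_le _ _).trans (Finset.sum_le_sum fun i _ => ?_)
        refine (norm_sum_le _ _).trans (Finset.sum_le_sum fun k _ => ?_)
        rw [norm_mul, Complex.norm_conj]
        calc ‖∑ j, U₀ i j * X j k‖ * ‖J i k‖ ≤ (∑ j, 1 * r) * B := by
              refine mul_le_mul ((norm_sum_le _ _).trans (Finset.sum_le_sum fun j _ => ?_)) (hJ i k) (norm_nonneg _)
                (Finset.sum_nonneg fun _ _ => by positivity)
              rw [norm_mul]
              exact mul_le_mul (hU i j) (hX j k) (norm_nonneg _) zero_le_one
          _ = ∑ j, 1 * r * B := by rw [Finset.sum_mul]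
    _ = 27 * r * B := by simp only [Finset.sum_const, Finset.card_univ, Fintype.card_fin]; ring

/-! ## §2 The item -/

/-- **`TiltedHaarFlatness` (stmt-QuantumFields-17377), PROVED**: with `c` the tree's `SU(3)` Haar small-ball constant (`Haar{‖V−1‖ ≤ r} ≥ c r⁸`,
`r ≤ 1`), `C := e·27⁸/c` and `p := 8`: for all `B ≥ 0`, `J` with entries `≤ B`, `U₀ ∈ SU(3)`,
`e^{Re tr(U₀Jᴴ)} ≤ C(1+B)^p ∫ e^{Re tr(UJᴴ)} dHaar(U)` — left invariance + the Laplace lower bound on the ball `r = (1+27B)⁻¹`.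
[cite: VairinhosDeforcrand2014, §2] -/
theorem tiltedHaarFlatness_proof : Summit.QuantumFields.QCD.Theses.GaussianLinkFrames.TiltedHaarFlatness := by
  obtain ⟨c, hc, hc1, hball⟩ := haar_ball_ge_specialUnitaryGroup (n := Fin 3) (R := 1) one_pos
  refine ⟨Real.exp 1 * 27 ^ 8 / c, 8, by positivity, ?_⟩
  intro B hB J hJ U₀
  set μ : Measure (Matrix.specialUnitaryGroup (Fin 3) ℂ) := haarProbability (Matrix.specialUnitaryGroup (Fin 3) ℂ) with hμ
  haveI : IsProbabilityMeasure μ := by rw [hμ]; infer_instance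
  haveI : μ.IsMulLeftInvariant := by rw [hμ]; unfold haarProbability; infer_instance
  -- the integrand
  set f : Matrix.specialUnitaryGroup (Fin 3) ℂ → ℝ := fun U => Real.exp (((U : Matrix (Fin 3) (Fin 3) ℂ) * Jᴴ).trace.re) with hf
  have hfcont : Continuous f := by
    refine Real.continuous_exp.comp (Complex.continuous_re.comp ?_)
    exact (continuous_subtype_val.matrix_mul continuous_const).matrix_trace
  have hfint : Integrable f μ := hfcont.integrable_of_hasCompactSupport (HasCompactSupport.of_compactSpace f)
  have hf0 : ∀ U, 0 ≤ f U := fun U => (Real.exp_pos _).le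
  -- the radius and the ball
  set r : ℝ := (1 + 27 * B)⁻¹ with hr
  have hr0 : 0 < r := by rw [hr]; positivity
  have hr1 : r ≤ 1 := by rw [hr]; exact inv_le_one_of_one_le₀ (by linarith)
  set S : Set (Matrix.specialUnitaryGroup (Fin 3) ℂ) := {V | ‖(V : Matrix (Fin 3) (Fin 3) ℂ) - 1‖ ≤ r} with hS
  have hSmeas : MeasurableSet S :=
    (isClosed_le ((continuous_subtype_val.sub continuous_const).norm) continuous_const).measurableSet
  -- Haar mass of the ball
  have hballS : c * r ^ 8 ≤ μ.real S := by
    have h := hball μ r hr0 hr1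
    rw [Fintype.card_fin] at h
    have h' : ENNReal.ofReal (c * r ^ 8) ≤ μ S := by simpa using h
    rw [measureReal_def]
    exact (ENNReal.ofReal_le_iff_le_toReal (measure_ne_top μ S)).mp h'
  -- on the translated ball the exponent drops by at most 1
  set a : ℝ := (((U₀ : Matrix (Fin 3) (Fin 3) ℂ) * Jᴴ).trace).re with ha
  have hlow : ∀ V ∈ S, Real.exp (a - 1) ≤ f (U₀ * V) := by
    intro V hV
    rw [hf]
    refine Real.exp_le_exp.mpr ?_
    have hcoe : ((U₀ * V : Matrix.specialUnitaryGroup (Fin 3) ℂ) : Matrix (Fin 3) (Fin 3) ℂ) =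
        (U₀ : Matrix (Fin 3) (Fin 3) ℂ) * (V : Matrix (Fin 3) (Fin 3) ℂ) := rfl
    have hsplit : (((U₀ : Matrix (Fin 3) (Fin 3) ℂ) * (V : Matrix (Fin 3) (Fin 3) ℂ)) * Jᴴ).trace.re =
        a + (((U₀ : Matrix (Fin 3) (Fin 3) ℂ) * ((V : Matrix (Fin 3) (Fin 3) ℂ) - 1) * Jᴴ).trace).re := by
      rw [ha, ← Complex.add_re, ← Matrix.trace_add, Matrix.mul_sub, Matrix.sub_mul, Matrix.mul_one]
      congr 2; abel
    rw [hcoe, hsplit]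
    have hbound := abs_re_trace_mul_mul_le (U₀ := (U₀ : Matrix (Fin 3) (Fin 3) ℂ))
      (X := (V : Matrix (Fin 3) (Fin 3) ℂ) - 1) (J := J) (r := r) (B := B)
      (fun i j => entry_norm_bound_of_unitary U₀.prop.1 i j)
      (fun i j => (norm_entry_le_l2_opNorm _ i j).trans hV) hJ
    have h27 : 27 * r * B ≤ 1 := by
      rw [hr]
      rw [show 27 * (1 + 27 * B)⁻¹ * B = (27 * B) / (1 + 27 * B) by ring, div_le_one (by positivity)]
      linarith
    have := neg_abs_le (((U₀ : Matrix (Fin 3) (Fin 3) ℂ) * ((V : Matrix (Fin 3) (Fin 3) ℂ) - 1) * Jᴴ).trace).re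
    linarith
  -- the Laplace lower bound
  have hmain : Real.exp (a - 1) * (c * r ^ 8) ≤ ∫ U, f U ∂μ := by
    calc Real.exp (a - 1) * (c * r ^ 8) ≤ Real.exp (a - 1) * μ.real S :=
          mul_le_mul_of_nonneg_left hballS (Real.exp_pos _).le
      _ = μ.real S • Real.exp (a - 1) := by rw [smul_eq_mul, mul_comm]
      _ ≤ ∫ V in S, f (U₀ * V) ∂μ :=
          setIntegral_ge_of_const_le hSmeas (measure_ne_top μ S) hlow
            ((hfcont.comp (continuous_const.mul continuous_id)).integrable_of_hasCompactSupport
              (HasCompactSupport.of_compactSpace _)).integrableOn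
      _ ≤ ∫ V, f (U₀ * V) ∂μ :=
          setIntegral_le_integral ((hfcont.comp (continuous_const.mul continuous_id)).integrable_of_hasCompactSupport
            (HasCompactSupport.of_compactSpace _)) (Filter.Eventually.of_forall fun V => hf0 _)
      _ = ∫ U, f U ∂μ := integral_mul_left_eq_self f U₀
  -- conclude
  have hI0 : 0 ≤ ∫ U, f U ∂μ := integral_nonneg hf0
  have hrpow : (1 + B) ^ (8 : ℝ) = (1 + B) ^ (8 : ℕ) := by
    rw [show (8 : ℝ) = ((8 : ℕ) : ℝ) by norm_num, Real.rpow_natCast]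
  rw [hrpow]
  -- `e^a ≤ e · (c r⁸)⁻¹ · ∫ f` and `(c r⁸)⁻¹ = (1+27B)⁸/c ≤ 27⁸(1+B)⁸/c`
  have hcr : 0 < c * r ^ 8 := by positivity
  have h1 : Real.exp a ≤ Real.exp 1 / (c * r ^ 8) * ∫ U, f U ∂μ := by
    rw [div_mul_eq_mul_div, le_div_iff₀ hcr]
    calc Real.exp a * (c * r ^ 8) = Real.exp 1 * (Real.exp (a - 1) * (c * r ^ 8)) := by
          rw [show Real.exp a = Real.exp 1 * Real.exp (a - 1) by rw [← Real.exp_add]; congr 1; ring]; ring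
      _ ≤ Real.exp 1 * ∫ U, f U ∂μ := mul_le_mul_of_nonneg_left hmain (Real.exp_pos 1).le
  have h2 : Real.exp 1 / (c * r ^ 8) ≤ Real.exp 1 * 27 ^ 8 / c * (1 + B) ^ (8 : ℕ) := by
    rw [hr, inv_pow, show Real.exp 1 / (c * ((1 + 27 * B) ^ 8)⁻¹) = Real.exp 1 / c * (1 + 27 * B) ^ 8 by
      field_simp]
    rw [show Real.exp 1 * 27 ^ 8 / c * (1 + B) ^ (8 : ℕ) = Real.exp 1 / c * (27 * (1 + B)) ^ 8 by ring]
    exact mul_le_mul_of_nonneg_left (pow_le_pow_left₀ (by positivity) (by linarith) 8) (by positivity)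
  exact h1.trans (mul_le_mul_of_nonneg_right h2 hI0)

end Summit.QuantumFields.QCD.Theorems.GaussianLinkFramesTiltedHaarFlatness

end
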